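import Mathlib
import HarnessLib
import Summits.Langlands.Langlands.Statement
import Summits.Langlands.Langlands.Theorems.SkinnerWilesDefectOneQuadraticBaseChangeGalois
import Literature.NumberTheory.Automorphic.BaseChangeStrongAllFinite
import Literature.NumberTheory.Automorphic.QuadraticBaseChangeFrobCompatibleProofs
import Summits.Langlands.Langlands.Theses.SkinnerWilesDefectOne

/-!
# `QuadraticBaseChangeGalois` from strong lifting at all finite places, MODULO its exact residue
# at the ramified primes of `π` (helper for item stmt-Langlands-15195 of route `SkinnerWilesDefectOne`)

The route-choice repair of 2026-08-16 rewired the base-change crux of `SkinnerWilesDefectOne` as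
`StrongLiftingAllFinite → QuadraticBaseChangeGalois` (item stmt-Langlands-15195,
`QuadraticBaseChangeGaloisOfStrongLifting`), the antecedent being Arthur–Clozel's strong lifting at
ALL finite places (Ch. 3 Thm. 5.1; the named fact `ArthurClozel1989_strongLifting_allFinite`, filed
verbatim as the route item `StrongLiftingAllFinite`, stmt-Langlands-15194).  This helper records,
against the Literature constant (the route decl is definitionally equal to it), exactly how far
strong lifting carries the crux and what is left:

* `quadraticBaseChangeGalois_of_strongLiftingAllFinite_of_residue` — granted
  (1) `baseChange_cyclic_cuspidal` (Arthur–Clozel Ch. 3 Thm. 4.2 (a): the weak lift of a cuspidal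
  non-dihedral `π` is cuspidal), (2) `ArthurClozel1989_strongLifting_archimedean` (Thm. 5.1 at `∞`
  with Ch. 1 §7), lang.S27 `exists_galoisRep_of_regularAlgebraic` over `ℚ` (Harris–Lan–Taylor–Thorne
  Thm. A with Varma: compatibility at EVERY unramified `ℓ ≠ p`), strong lifting at all finite places
  `ArthurClozel1989_strongLifting_allFinite`, AND the explicit hypothesis `hres` — the conclusion of
  fact (3) `Langlands1980_quadraticBaseChange_frobCompatible` demanded ONLY at the finite `w ∤ p` of
  `F` over a prime at which `π` is RAMIFIED (with `ρ|_{Γ_F}` unramified at `w`) — the crux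
  `QuadraticBaseChangeGalois` holds for every quadratic `F/ℚ`, real or imaginary.

`hres` is a hypothesis written out in full, not a named fact (it is the `n = 2` residue of fact (3),
which implies it by dropping one hypothesis; a slice of a fact is not re-vendored, D-0026).  Why
strong lifting of UNRAMIFIED `π_ℓ` cannot discharge it: at a prime `ℓ` ramified in `F` a ramified
principal series `π_ℓ = π(μ₁, μ₂)` with exactly one `μ_i|_{ℤ_ℓ^×}` equal to the quadratic character
of `F_w/ℚ_ℓ` (Galois side: `ρ|_{I_ℓ} ≅ 1 ⊕ η_F`, so `ρ|_{Γ_F}` IS unramified at `w`) has the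
unramified lift `P_w = π(μ₁ ∘ N, μ₂ ∘ N)` (Langlands 1980 §2 (i); Arthur–Clozel Ch. 1 §6), while
`π ⊗ χ` stays ramified at `ℓ` for every Dirichlet character `χ`; Thm. 5.1-for-unramified-`π_ℓ` is
silent there, and in the datum model `t_{P,w}` is then reachable only through fact (3) itself or
through Carayol's theorem over an auxiliary real quadratic field together with the DESCENT clause
(ii) of `ArthurClozel1989_strongLifting_unramified` (Literature:
`Langlands1980_quadraticBaseChange_frobCompatible_of_carayol'`, file `…SplitAuxFieldProofs`).

## References

* R. P. Langlands, *Base Change for GL(2)*, Ann. of Math. Stud. 96 (1980), §2 (A), (F), (i).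
  [LanglandsBaseChange1980]
* J. Arthur, L. Clozel, *Simple algebras, base change, and the advanced theory of the trace
  formula*, Ann. of Math. Stud. 120 (1989), Ch. 3 Thm. 4.2 (a), Thm. 5.1, §1 (1.1); Ch. 1 §6–§7,
  Prop. 6.7. [ArthurClozelAMS120]
* H. Carayol, *Sur les représentations ℓ-adiques associées aux formes modulaires de Hilbert*, Ann.
  Sci. ÉNS 19 (1986), Thm. (A), §12.2. [CarayolASENS1986]
* M. Harris, K.-W. Lan, R. Taylor, J. Thorne, *On the rigid cohomology of certain Shimura
  varieties*, Res. Math. Sci. 3 (2016), Thm. A. [HarrisLanTaylorThorneRMS2016]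
-/

set_option linter.dupNamespace false -- project-wide option (lakefile weak.linter.dupNamespace); `Summit.Langlands.Langlands` is the mandated namespace

noncomputable section

open scoped MatrixGroups Matrix NumberField Polynomial Classical
open NumberField IsDedekindDomain Field Polynomial Filter
open Literature.NumberTheory.Automorphic Literature.NumberTheory.GaloisRepresentations

namespace Summit.Langlands.Langlands.Theorems.SkinnerWilesDefectOne

/-- **`QuadraticBaseChangeGalois` from strong lifting at all finite places, modulo its exact residue
at the ramified primes of `π`.**  Granted (1) `baseChange_cyclic_cuspidal` (Arthur–Clozel Ch. 3
Thm. 4.2 (a)), (2) `ArthurClozel1989_strongLifting_archimedean` (Thm. 5.1 at `∞`, Ch. 1 §7),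
lang.S27 `exists_galoisRep_of_regularAlgebraic` over `ℚ`, Arthur–Clozel's strong lifting at ALL
finite places `ArthurClozel1989_strongLifting_allFinite` (Thm. 5.1: `t_{P,w} = t_{π,ℓ}^{f(w|ℓ)}`
whenever `π_ℓ` is unramified — also at `ℓ` ramified in `F`), AND the explicit hypothesis `hres` —
the conclusion of fact (3) `Langlands1980_quadraticBaseChange_frobCompatible` (Langlands 1980 §2 (A),
(F) with the local lifting (i) of ramified principal series; Carayol 1986 Thm. (A) in Weil–Deligne
form with §12.2) demanded ONLY at the finite `w ∤ p` of `F` lying over a prime at which `π` is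
RAMIFIED and `ρ|_{Γ_F}` is unramified —: for `F/ℚ` quadratic, `π` cuspidal on `GL₂(𝔸_ℚ)` with a
regular L-algebraic infinity type `T`, `ρ : Γ_ℚ → GL₂(ℚ̄_p)` Satake–Frobenius compatible with `π`
almost everywhere and `ρ|_{Γ_F}` irreducible, there is a cuspidal `P` on `GL₂(𝔸_F)` of infinity
type `τ ↦ T(τ|_ℚ)`, Satake–Frobenius compatible with `ρ|_{Γ_F}` at every finite `w ∤ p` where
`ρ|_{Γ_F}` is unramified — i.e. the route statement `QuadraticBaseChangeGalois` (first step
`unfold`).  Proof: the cuspidal lift `P` from (1) and the proved non-dihedral lemma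
`exists_inert_hasSatakeParamAt_map_ne`, its infinity type from (2); at `w ∤ p`, `by_cases` on
`π.1.IsUnramifiedAt (w.under (𝓞 ℚ))` — the unramified case is lang.S27 over `ℚ` at `ℓ = w ∩ ℤ`
followed by strong lifting at `w ∣ ℓ`
(`Langlands1980_quadraticBaseChange_frobCompatible_at_of_isUnramifiedAt_under`), the ramified case
is `hres`.  Strong lifting of unramified `π_ℓ` cannot supply `hres` (module docstring: ramified
principal series of mixed quadratic type at a prime ramified in `F`).
[cite: LanglandsBaseChange1980, §2 (A), (F) with (i)]
[cite: ArthurClozelAMS120, Ch. 3 Thm. 4.2 (a) and Thm. 5.1] [cite: CarayolASENS1986, Thm. (A) and §12.2]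
[cite: HarrisLanTaylorThorneRMS2016, Thm. A] -/
theorem quadraticBaseChangeGalois_of_strongLiftingAllFinite_of_residue
    (h₁ : Literature.NumberTheory.Automorphic.baseChange_cyclic_cuspidal)
    (h₂ : Literature.NumberTheory.Automorphic.ArthurClozel1989_strongLifting_archimedean)
    (h27 : Literature.NumberTheory.Automorphic.exists_galoisRep_of_regularAlgebraic)
    (hAC : Literature.NumberTheory.Automorphic.ArthurClozel1989_strongLifting_allFinite)
    (hres : ∀ (F : Type) [Field F] [NumberField F], Module.finrank ℚ F = 2 →
      ∀ (p : ℕ) [Fact p.Prime] (ι : PadicAlgCl p ≃+* ℂ)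
        (hQ : Literature.NumberTheory.Automorphic.isCompact_glFiniteIntegralLevel 2 ℚ)
        (hF : Literature.NumberTheory.Automorphic.isCompact_glFiniteIntegralLevel 2 F)
        (π : Literature.NumberTheory.Automorphic.CuspidalAutomorphicRepData 2 ℚ hQ)
        (T : Literature.NumberTheory.Automorphic.InfinityType ℚ 2),
        π.1.HasInfinityType T → T.IsLAlgebraic → T.IsRegular →
      ∀ (ρ : Literature.NumberTheory.GaloisRepresentations.FramedGaloisRep ℚ (PadicAlgCl p) 2),
        ρ.toGaloisRep.IsIrreducible →
        (∀ᶠ v : IsDedekindDomain.HeightOneSpectrum (NumberField.RingOfIntegers ℚ) in Filter.cofinite,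
          ∃ α : Multiset ℂ, π.1.HasSatakeParamAt v α ∧ ρ.IsUnramifiedAt v ∧
            ρ.HasFrobCharpolyAt v
              (Literature.NumberTheory.Automorphic.arithFrobPolyOfSatake ι v.residueCard 1 α)) →
      ∀ (P : Literature.NumberTheory.Automorphic.CuspidalAutomorphicRepData 2 F hF),
        Literature.NumberTheory.Automorphic.IsWeakBaseChangeLiftAE π.1 P.1 →
      ∀ w : IsDedekindDomain.HeightOneSpectrum (NumberField.RingOfIntegers F),
        (p : NumberField.RingOfIntegers F) ∉ w.asIdeal → (ρ.restrictField F).IsUnramifiedAt w →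
        ¬ π.1.IsUnramifiedAt (w.under (NumberField.RingOfIntegers ℚ)) →
        ∃ α : Multiset ℂ, P.1.HasSatakeParamAt w α ∧ (ρ.restrictField F).IsUnramifiedAt w ∧
          (ρ.restrictField F).HasFrobCharpolyAt w
            (Literature.NumberTheory.Automorphic.arithFrobPolyOfSatake ι w.residueCard 1 α)) :
    Summit.Langlands.Langlands.Theses.SkinnerWilesDefectOne.QuadraticBaseChangeGalois := by
  unfold Summit.Langlands.Langlands.Theses.SkinnerWilesDefectOne.QuadraticBaseChangeGalois
  intro F _ _ hdeg p _ hcptQ hcptF ι π T hT hTL hTR ρ hcompat hirrF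
  -- `F/ℚ` quadratic: Galois of prime degree `2`
  haveI : Algebra.IsQuadraticExtension ℚ F := ⟨hdeg⟩
  haveI : IsGalois ℚ F := inferInstance
  have hprime : (Module.finrank ℚ F).Prime := hdeg ▸ Nat.prime_two
  -- `ρ` is irreducible since `ρ|_{Γ_F}` is
  have hρirr : ρ.toGaloisRep.IsIrreducible := isIrreducible_of_isIrreducible_restrictField F ρ hirrF
  -- (1) + the non-dihedral lemma: the cuspidal weak base-change lift `P`
  have hne :=
    EisensteinProModularSeed.exists_inert_hasSatakeParamAt_map_ne F hdeg ι π.1 ρ hcompat hirrF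
  obtain ⟨P, hBC⟩ := h₁ 2 ℚ F hprime hcptQ π hne hcptF
  -- (2): its infinity type is `T^F`
  have hPT : P.1.HasInfinityType (T.baseChange F) :=
    h₂.hasInfinityType_baseChange inferInstance hprime hBC hT
  refine ⟨P, hPT, fun w hwp hunr => ?_⟩
  by_cases hπ : π.1.IsUnramifiedAt (w.under (𝓞 ℚ))
  · -- good prime: lang.S27 over `ℚ` at `ℓ = w ∩ ℤ`, then strong lifting at `w ∣ ℓ`
    exact Langlands1980_quadraticBaseChange_frobCompatible_at_of_isUnramifiedAt_under hAC h27 hdeg ι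
      π hT hTL hTR ρ hρirr hcompat P hBC w hwp hπ
  · -- ramified prime of `π`: the residue
    exact hres F hdeg p ι hcptQ hcptF π T hT hTL hTR ρ hρirr hcompat P hBC w hwp hunr hπ

end Summit.Langlands.Langlands.Theorems.SkinnerWilesDefectOne

end
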